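import Summits.QuantumFields.YangMills.Theorems.SwapVirialDeficitBlowUpGnomonicCartHubDefs
import Summits.QuantumFields.YangMills.Theorems.SwapVirialDeficitSectorLaplaceDefs
import Summits.QuantumFields.YangMills.Theorems.SwapVirialDeficitBlowUpVirialChart
import Mathlib.MeasureTheory.Measure.Haar.InnerProductSpace
import HarnessLib

/-!
# Route `SwapVirialDeficit` (YangMills): THE FIXED-FRAME DEFICIT HAS THE SAME HUB INTEGRALS — `gnoRot u` preserves the fibre measure
# (brick P1b(ii) of w2 g60's memo2 = plan of record for `stub_core_tip` of skeleton ➎; free-hands support of ⟨stmt-QuantumFields-24197⟩ `SwapVirialDeficit.SwapGluedStiffness`)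

* §1 `volume_preserving_rot3` (the letter rotation `rot3 u`, `‖u‖ = 1`, preserves Lebesgue measure on `ℝ³`: an isometry of `EuclideanSpace ℝ (Fin 3)` by ✓`normSq3_rot3`),
  `volume_preserving_gnoRot` (on `GnoCoord L`, blockwise), `gnoDensity_gnoRot` (`ρ(gnoRot u η) = ρ(η)`);
* §2 ★★ `hubIntegral_eq_cart` — for `a ≠ 0` and a unit `u` with `ū·radialUnit(axisPoint a)·u = radialUnit a`:
  `∫ e^{−b F̂cart_{a,ε}(η)} ρ(η) dη = hubIntegral a ε b` (✓`gnoDeficitCart_gnoRot` + §1): the tip ∕ shell hub integrals may be computed with the fixed-frame deficit,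
  which is smooth across the apex — the integrand for ✓`lintegral_coneMeasure_hubCart`.

HONEST LABEL: measure bookkeeping; `stub_core_tip` and the other stubs, ⟨24197⟩ ∕ ⟨24194⟩ OPEN; own crux ⟨22884⟩ `LargeFieldMassRefinementTail` OPEN (blocked-on ⟨19935⟩); the Yang–Mills
mass gap is NOT proved; no summit is proved by a line.  THEOREMS ONLY (0 `def`, 0 `sorry`), standard axioms; the route's local `ℍ` measurability instances.
Width seat ym-line-sfw-p2-w2 g60 (cell ym-idea-1, free hands), `--supports stmt-QuantumFields-24197`.  References: [folklore].
-/

set_option autoImplicit false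

noncomputable section

open MeasureTheory Quaternion Set Module
open scoped Quaternion ENNReal BigOperators
open Literature.MathematicalPhysics.QuantumLattice
open Literature.MathematicalPhysics.QuantumFieldTheory hiding SU2

attribute [local instance] Literature.Analysis.FluidPDE.Tao2016.quatMeasurableSpace
  Literature.Analysis.FluidPDE.Tao2016.quatBorelSpace
  Literature.MathematicalPhysics.QuantumLattice.secondCountableTopology_su2

namespace Summit.QuantumFields.YangMills.Theorems.SwapVirialDeficit.BlowUpRing

open Summit.QuantumFields.YangMills.Theorems.FemtoTransferGap
open Summit.QuantumFields.YangMills.Theorems.FemtoTransferGap.TT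
open Summit.QuantumFields.YangMills.Theorems.VirialFluxGap.RingDeficit
open Summit.QuantumFields.YangMills.Theorems.SwapVirialDeficit.SwapRing
open Summit.QuantumFields.YangMills.Theorems.SwapVirialDeficit.SectorLaplace
open Summit.QuantumFields.YangMills.Theorems.SwapVirialDeficit.Gnomonic (normSq3 normSq3_nonneg gnomonicWeight piWeight)
open Literature.Analysis.Calculus (radialUnit)
open Summit.QuantumFields.YangMills.Theorems.SwapTwistDeficit.ToronLog (axisPoint)

variable {L : ℕ} [NeZero L]

/-! ## §1 `rot3 u` and `gnoRot u` preserve the measure and the density -/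

omit [NeZero L] in
/-- ★ For a unit `u`, the letter rotation `rot3 u` preserves Lebesgue measure on `ℝ³` (it is a linear isometry of `EuclideanSpace ℝ (Fin 3)`, ✓`normSq3_rot3`). [folklore] -/
theorem volume_preserving_rot3 {u : ℍ} (hu : ‖u‖ = 1) : MeasurePreserving (rot3 u : (Fin 3 → ℝ) → (Fin 3 → ℝ)) volume volume := by
  -- the isometry of `EuclideanSpace ℝ (Fin 3)`
  let R₀ : EuclideanSpace ℝ (Fin 3) →ₗᵢ[ℝ] EuclideanSpace ℝ (Fin 3) :=
    { toFun := fun v => WithLp.toLp 2 (rot3 u (WithLp.ofLp v))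
      map_add' := fun v w => by
        refine PiLp.ext fun k => ?_
        simp [rot3_add]
      map_smul' := fun c v => by
        refine PiLp.ext fun k => ?_
        simp [rot3_smul]
      norm_map' := fun v => by
        have h : ‖(WithLp.toLp 2 (rot3 u (WithLp.ofLp v)) : EuclideanSpace ℝ (Fin 3))‖ ^ 2 = ‖v‖ ^ 2 := by
          rw [EuclideanSpace.real_norm_sq_eq, EuclideanSpace.real_norm_sq_eq]
          have h1 := normSq3_rot3 hu (WithLp.ofLp v)
          simp only [normSq3] at h1
          simpa using h1
        exact (sq_eq_sq₀ (norm_nonneg _) (norm_nonneg _)).1 h }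
  have hfin : finrank ℝ (EuclideanSpace ℝ (Fin 3)) = finrank ℝ (EuclideanSpace ℝ (Fin 3)) := rfl
  have hR : MeasurePreserving (R₀.toLinearIsometryEquiv hfin) volume volume := (R₀.toLinearIsometryEquiv hfin).measurePreserving
  have h1 : MeasurePreserving (fun v : Fin 3 → ℝ => (R₀.toLinearIsometryEquiv hfin) (WithLp.toLp 2 v)) volume volume :=
    hR.comp (PiLp.volume_preserving_toLp (Fin 3))
  have h2 : MeasurePreserving (fun v : Fin 3 → ℝ => WithLp.ofLp ((R₀.toLinearIsometryEquiv hfin) (WithLp.toLp 2 v))) volume volume :=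
    (PiLp.volume_preserving_ofLp (Fin 3)).comp h1
  have e : (fun v : Fin 3 → ℝ => rot3 u v) = fun v : Fin 3 → ℝ => WithLp.ofLp ((R₀.toLinearIsometryEquiv hfin) (WithLp.toLp 2 v)) := by
    funext v; rfl
  rw [show (rot3 u : (Fin 3 → ℝ) → (Fin 3 → ℝ)) = fun v => rot3 u v from rfl, e]
  exact h2

/-- ★ `gnoRot u` preserves the volume of `GnoCoord L` (blockwise ✓`volume_preserving_rot3`). [folklore] -/
theorem volume_preserving_gnoRot {u : ℍ} (hu : ‖u‖ = 1) : MeasurePreserving (gnoRot (L := L) u) volume volume := by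
  have h3 := volume_preserving_rot3 hu
  have hF : MeasurePreserving (fun F : Fol L → Fin 3 → ℝ => fun f => rot3 u (F f)) volume volume :=
    volume_preserving_pi (fun _ : Fol L => h3)
  have h := (h3.prod h3).prod (h3.prod hF)
  exact h

/-- `ρ` is `gnoRot`-invariant: `gnoDensity (gnoRot u η) = gnoDensity η` (every weight depends on `|letter|²`, ✓`normSq3_rot3`). [folklore] -/
theorem gnoDensity_gnoRot {u : ℍ} (hu : ‖u‖ = 1) (η : GnoCoord L) : gnoDensity (gnoRot u η) = gnoDensity η := by
  have hw : ∀ v : Fin 3 → ℝ, gnomonicWeight (rot3 u v) = gnomonicWeight v := fun v => by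
    simp only [gnomonicWeight, normSq3_rot3 hu]
  simp only [gnoDensity, gnoRot, hw, piWeight]

/-! ## §2 Measurability and the hub integral with the fixed-frame deficit -/

omit [NeZero L] in
/-- `(a, w) ↦ leaderTupleCart a w` is measurable (pattern of ✓`measurable_leaderTuple`, with ✓`measurable_radialUnit`). [folklore] -/
theorem measurable_leaderTupleCart : Measurable fun q : ℍ × ((ℍ × ℍ) × ℍ) => leaderTupleCart q.1 q.2 := by
  have hA : Measurable fun q : ℍ × ((ℍ × ℍ) × ℍ) => radialUnit q.1 := ZeroModeSigma.measurable_radialUnit.comp measurable_fst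
  have hx : Measurable fun q : ℍ × ((ℍ × ℍ) × ℍ) => q.2.1.1 := measurable_fst.comp (measurable_fst.comp measurable_snd)
  have hy : Measurable fun q : ℍ × ((ℍ × ℍ) × ℍ) => q.2.1.2 := measurable_snd.comp (measurable_fst.comp measurable_snd)
  have hz : Measurable fun q : ℍ × ((ℍ × ℍ) × ℍ) => q.2.2 := measurable_snd.comp measurable_snd
  have hp : Measurable fun q : ℍ × ((ℍ × ℍ) × ℍ) => ZeroModeSigma.slaveP (radialUnit q.1) q.2.1.1 * q.2.2 :=
    (ZeroModeSigma.measurable_slaveP.comp (hA.prodMk hx)).mul hz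
  exact BlowUp.measurable_vec4 (measurable_quatToSU2.comp hx) (measurable_quatToSU2.comp hp) (measurable_quatToSU2.comp hy)
    (measurable_quatToSU2.comp hA)

omit [NeZero L] in
/-- `(a, η) ↦ cartPoint a ε η` is measurable. [folklore] -/
theorem measurable_cartPoint_uncurry (ε : GnoSign L) : Measurable fun p : ℍ × GnoCoord L => cartPoint p.1 ε p.2 := by
  have hG := measurable_gnomonicPoint_uncurry (L := L) ε
  have hM : Measurable fun q : ℍ × (((ℍ × ℍ) × ℍ) × (Fol L → ℍ)) => ((leaderTupleCart q.1 q.2.1), (fun i => quatToSU2 (q.2.2 i))) := by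
    refine (measurable_leaderTupleCart.comp (measurable_fst.prodMk (measurable_fst.comp measurable_snd))).prodMk ?_
    exact measurable_pi_lambda _ fun i => measurable_quatToSU2.comp ((measurable_pi_apply i).comp (measurable_snd.comp measurable_snd))
  have e : (fun p : ℍ × GnoCoord L => cartPoint p.1 ε p.2) =
      (fun q : ℍ × (((ℍ × ℍ) × ℍ) × (Fol L → ℍ)) => ((leaderTupleCart q.1 q.2.1), (fun i => quatToSU2 (q.2.2 i)))) ∘ fun p => gnomonicPoint p.1 ε p.2 := by
    funext p; rfl
  rw [e]; exact hM.comp hG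

/-- ★ `(a, η) ↦ F̂cart_{z,a,ε}(η)` is jointly measurable. [folklore] -/
theorem measurable_gnoDeficitCart_uncurry (z : Fin 3 → Bool) (χ : Site 3 L → SU2) (ε : GnoSign L) :
    Measurable fun p : ℍ × GnoCoord L => gnoDeficitCart z χ p.1 ε p.2 :=
  (measurable_chartDeficit z χ).comp (measurable_cartPoint_uncurry ε)

/-- `η ↦ F̂cart_{z,a,ε}(η)` is measurable at a fixed hub. [folklore] -/
theorem measurable_gnoDeficitCart (z : Fin 3 → Bool) (χ : Site 3 L → SU2) (a : ℍ) (ε : GnoSign L) :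
    Measurable fun η : GnoCoord L => gnoDeficitCart z χ a ε η := by
  have hpy : Measurable fun η : GnoCoord L => (a, η) := measurable_const.prodMk measurable_id
  have h := Measurable.comp (measurable_gnoDeficitCart_uncurry z χ ε) hpy
  exact h

/-- ★★ **THE FIXED-FRAME DEFICIT HAS THE SAME HUB INTEGRAL**: for `a ≠ 0`, a unit `u` with `ū·radialUnit(axisPoint a)·u = radialUnit a` and every `b`,
`∫ e^{−b F̂cart_{a,ε}(η)} ρ(η) dη = hubIntegral a ε b` (change of variables `η = gnoRot u η′`, ✓`gnoDeficitCart_gnoRot_one`, §1). [folklore] -/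
theorem hubIntegral_eq_cart {a : ℍ} (ha : a ≠ 0) {u : ℍ} (hu : ‖u‖ = 1) (hua : star u * radialUnit (axisPoint a) * u = radialUnit a) (ε : GnoSign L) (b : ℝ) :
    ∫ η : GnoCoord L, Real.exp (-(b * gnoDeficitCart z₀ (fun _ => 1) a ε η)) * gnoDensity η = hubIntegral a ε b := by
  unfold hubIntegral
  have hmp := volume_preserving_gnoRot (L := L) hu
  have hG : Measurable fun η : GnoCoord L => Real.exp (-(b * gnoDeficitCart z₀ (fun _ => 1) a ε η)) * gnoDensity η :=
    ((measurable_gnoDeficitCart z₀ (fun _ => 1) a ε).const_mul b).neg.exp.mul measurable_gnoDensity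
  rw [← hmp.map_eq, integral_map hmp.measurable.aemeasurable hG.aestronglyMeasurable, hmp.map_eq]
  refine integral_congr_ae (Filter.Eventually.of_forall fun η => ?_)
  show Real.exp (-(b * gnoDeficitCart z₀ (fun _ => 1) a ε (gnoRot u η))) * gnoDensity (gnoRot u η) = _
  rw [gnoDeficitCart_gnoRot_one z₀ ha hu hua, gnoDensity_gnoRot hu]

end Summit.QuantumFields.YangMills.Theorems.SwapVirialDeficit.BlowUpRing

end
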